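import Summits.BirchSwinnertonDyer.Rank1Residual.X1.RankOneCertificateRows
import Summits.BirchSwinnertonDyer.Rank1Residual.X1.RankOneRegulatorSqueezeSha
import HarnessLib

/-!
# X1 ∩ {r = 1}: the EXTENDED certificate-row record — route P₁ ∨ route R ∨ route R with `Ш`-defect
# `2` (Cassels–Tate + ONE non-zero element of `Ш(E′)[p]`), read on ANY curve `E′` of the class

HONEST FRAMING (cell `b2b-bsdres`, run/shared/lean/b2b/bsd-rank1-residual/, verbatim in every
file): the goal of the cell is to DELETE the COMBINATION-SHAPED residual classes of the
Birch–Swinnerton-Dyer formula for ALL analytic-rank `≤ 1` elliptic curves over `ℚ` — "full BSD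
formula for every rank `≤ 1` curve in class `C`" assembled STRICTLY from published theorems — so
that the rank-`≤ 1` remainder becomes exactly the CONSTRUCTION-SHAPED classes, which are TYPED
(missing-input `Prop`s), NOT attempted. This is not "finishing BSD". CLASS-OWNERS.md: row
"X1 (r = 1)" — research route; NO CLAIM BEYOND STATED CLASSES; no label change; PER-PAIR certificate
shape, not a class theorem; nothing is booked by this file; no preprint enters; NO definition, NO
named fact.

Unit `b2b-bsdres-x1a` (X1 prover A, gen 18). Sequel of `X1/RankOneCertificateRows.lean` (p289304,
the ROW RECORD of the lane offer `class-closure/N1/OFFER-T-X1R1-RP1-x1a.md`: route P₁ ∨ route R) and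
of `X1/RankOneRegulatorSqueezeSha.lean` (p289683, route R with a `Ш`-defect). WHAT. The v1.1 offer
covers 9 197 of the 9 199 rank-one N1/N1′ cells; one of the two cells outside it, `371522j @3`, has
`#Ш_an = 9` at BOTH curves of its class, so neither curve carries a plain route-R row (`s = 2`), but
x1b's `φ`-descent (gen 28, kit j136107) exhibits a non-zero element of `Ш(371522j1)[3]`. The kernel
record for such a row is p289683's
`RankOne.Leaf.mazurMainConjecture_and_bsdp_of_regulatorGE_of_casselsTate_of_exists_torsion`, stated
AT the pair. This file supplies what a census row needs on top: (§1) its BOOKING (isogeny) form —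
the certificates `(vc, v)`, the defect-`2` squeeze and the witness `∃ x ∈ Ш(E′), x ≠ 0, p·x = 0` read
on ANY globally minimal `E′ ∼ E` give `BSDp E p` (Cassels' isogeny invariance at analytic rank `≤ 1`);
(§2) **the extended row record** `Leaf.bsdp_of_isIsogenous_of_certificateRowSha`: ONE theorem whose
per-row hypothesis is the three-way disjunction route P₁ ∨ route R ∨ route R-CT₂ (written inline, no
definition), with ONE binder list = the eight PUBLISHED facts of p289304 + the Cassels–Tate pairing
(`exists_casselsTate_pairing`, registry A24, PUB); every v1.1 row is a row of the extended record
(`Or.inl` / `Or.inr ∘ Or.inl`, §2 `certificateRowSha_of_certificateRow`); (§3) the class form.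

References: [Wuthrich2014] Thm. 16; [BalakrishnanMullerStein2015] Thm. 1.7; [PerrinRiou1987] §1.4
Cor. 1.8; [MazurSteinTate2006] Thm. 1.3; [MilneADT2006] Thm. I.7.3; [SilvermanAEC2009] Thm. X.4.14
(Cassels–Tate); HOME/b2b-bsdres-x1a/X1-CHAIN.md §25–§27; HOME/class-closure/N1/OFFER-T-X1R1-RP1-x1a.md
§10 (v1.2).
-/

noncomputable section

open scoped Classical MatrixGroups ModularForm

open PowerSeries CongruenceSubgroup WeierstrassCurve Literature.NumberTheory.EllipticCurves
  Literature.NumberTheory.EllipticCurves.ModularForms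
  Literature.NumberTheory.EllipticCurves.Wuthrich2014
  Literature.NumberTheory.EllipticCurves.Rank1Residual
  Summit.BirchSwinnertonDyer.BirchSwinnertonDyer.Theorems
  Summit.BirchSwinnertonDyer.BirchSwinnertonDyer.Theorems.Rank1ResidualX1Defs
  Summit.BirchSwinnertonDyer.Rank1Residual.X1.RankOneLeadingTermSqueeze

set_option autoImplicit false

namespace Summit.BirchSwinnertonDyer.Rank1Residual.X1.RankOne

variable {W : WeierstrassCurve ℚ} [W.IsElliptic] [W.IsGloballyMinimal] {p : ℕ} [Fact p.Prime]

/-! ## §1. Route R with `Ш`-defect `2` (Cassels–Tate + one element of `Ш[p]`) — booking (isogeny) form -/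

/-- **Route R-CT₂ read on ANY globally minimal curve `E′ ∼ E` of the class:** for a leaf pair `(E, p)`
and `E′ ∼ E` carrying the route-R certificates `ord_p(ϖ·[T¹]L_p) = vc ≠ 0`, `v ≤ ord_p Reg_p(E′)`,
the DEFECT-`2` squeeze `vc + 1 + 2·ord_p #E′(ℚ)_tors ≤ v + ord_p ∏c_ℓ(E′) + 2·ord_p #Ẽ′(𝔽_p) + 2` and
ONE non-zero element of `Ш(E′/ℚ)[p]` (a descent), `BSD(E,p)` — by p289683's Cassels–Tate shape at the
leaf pair `(E′, p)` (`Leaf.of_isIsogenous`) and Cassels' isogeny invariance of `BSD(·,p)` at analytic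
rank `≤ 1` (`Rank1ResidualX1Isogeny.bsdp_iff_of_isIsogenous`). PUBLISHED inputs only (Wuthrich Thm. 16,
BMS Thm. 1.7, Perrin-Riou 1987, Mazur–Tate `σ`, modularity, GZK, Cassels–Tate, Cassels).
[cite: Wuthrich2014, Thm. 16 (p. 397)] [cite: BalakrishnanMullerStein2015, Thm. 1.7]
[cite: PerrinRiou1987, §1.4 Cor. 1.8] [cite: SilvermanAEC2009, Thm. X.4.14]
[cite: MilneADT2006, Thm. I.7.3] -/
theorem Leaf.bsdp_of_isIsogenous_of_regulatorGE_of_casselsTate_of_exists_torsion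
    (hW16 : Wuthrich2014.charIdeal_dvd_padicLFunction) (hS : Schneider1985_order_charGenerator_odd)
    (hPR : perrinRiou_rankOne_leadingTerms_odd) (hMT : mazur_tate_sigma_exists_odd)
    (hmod : nonempty_modularParametrizationData) (hmod' : hasEntireLFunction_rat)
    (hGZK : rank_eq_analyticRank_of_analyticRank_le_one) (hCassels : bsdRHS_eq_of_isIsogenous)
    (hCT : exists_casselsTate_pairing (K := ℚ))
    (hL : Leaf W p) {W' : WeierstrassCurve ℚ} [W'.IsElliptic] [W'.IsGloballyMinimal]
    (hiso : IsIsogenous W W') {vc : ℤ} (hvc : vc ≠ 0) (hc : AnalyticCoeffOneVal W' p vc)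
    {v : ℤ} (hv : ∀ Dh : PAdicHeightData W' p, Dh.IsCanonical → v ≤ (padicRegulator Dh).valuation)
    (hb : vc + 1 + 2 * padicValNat p W'.torsionOrder ≤
      v + padicValNat p W'.tamagawaProduct + 2 * padicValNat p (W'.reductionPointCount p) + 2)
    (hw : ∃ x : W'.sha, x ≠ 0 ∧ p • x = 0) :
    BSDp W p :=
  (Rank1ResidualX1Isogeny.bsdp_iff_of_isIsogenous hGZK hmod' hCassels W W' hiso p (by rw [hL.2])).mpr
    ((hL.of_isIsogenous hiso).mazurMainConjecture_and_bsdp_of_regulatorGE_of_casselsTate_of_exists_torsion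
      hW16 hS hPR hMT hmod hGZK hCT hvc hc hv hb hw).2.1

/-- And on the certificate curve itself the row pins everything: Mazur's main conjecture at `(E′, p)`,
`BSD(E′,p)` and `#Ш(E′/ℚ)[p^∞] = p²` EXACTLY (restatement of p289683's theorem through
`Leaf.of_isIsogenous`, for the census sentence "MC ∧ BSD_p ∧ #Ш[p^∞] = p² at the certificate member").
[cite: Wuthrich2014, Thm. 16 (p. 397)] [cite: BalakrishnanMullerStein2015, Thm. 1.7]
[cite: PerrinRiou1987, §1.4 Cor. 1.8] [cite: SilvermanAEC2009, Thm. X.4.14] -/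
theorem Leaf.mazurMainConjecture_and_bsdp_and_card_of_isIsogenous_of_casselsTate_of_exists_torsion
    (hW16 : Wuthrich2014.charIdeal_dvd_padicLFunction) (hS : Schneider1985_order_charGenerator_odd)
    (hPR : perrinRiou_rankOne_leadingTerms_odd) (hMT : mazur_tate_sigma_exists_odd)
    (hmod : nonempty_modularParametrizationData) (hGZK : rank_eq_analyticRank_of_analyticRank_le_one)
    (hCT : exists_casselsTate_pairing (K := ℚ))
    (hL : Leaf W p) {W' : WeierstrassCurve ℚ} [W'.IsElliptic] [W'.IsGloballyMinimal]
    (hiso : IsIsogenous W W') {vc : ℤ} (hvc : vc ≠ 0) (hc : AnalyticCoeffOneVal W' p vc)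
    {v : ℤ} (hv : ∀ Dh : PAdicHeightData W' p, Dh.IsCanonical → v ≤ (padicRegulator Dh).valuation)
    (hb : vc + 1 + 2 * padicValNat p W'.torsionOrder ≤
      v + padicValNat p W'.tamagawaProduct + 2 * padicValNat p (W'.reductionPointCount p) + 2)
    (hw : ∃ x : W'.sha, x ≠ 0 ∧ p • x = 0) :
    MazurMainConjecture W' p ∧ BSDp W' p ∧
      Nat.card (AddCommGroup.primaryComponent W'.sha p) = p ^ 2 :=
  (hL.of_isIsogenous hiso).mazurMainConjecture_and_bsdp_of_regulatorGE_of_casselsTate_of_exists_torsion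
    hW16 hS hPR hMT hmod hGZK hCT hvc hc hv hb hw

/-! ## §2. The extended certificate row (route P₁ ∨ route R ∨ route R-CT₂) and its record -/

/-! An **extended certificate ROW at a pair `(E′, p)`** is the three-way DISJUNCTION (written inline
in every statement below; no definition is introduced): (P₁) the Néron-normalised linear coefficient
is a `p`-adic unit; OR (R) integers `vc ≠ 0`, `v` with `ord_p(ϖ·[T¹]L_p) = vc`, `v ≤ ord_p Reg_p(E′)`
at the canonical cyclotomic height and `vc + 1 + 2·ord_p #E′(ℚ)_tors ≤ v + ord_p ∏c_ℓ(E′) +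
2·ord_p #Ẽ′(𝔽_p)`; OR (R-CT₂) the same two certificates with the squeeze relaxed by `2` together
with ONE non-zero element of `Ш(E′/ℚ)[p]`. -/

/-- Every row of the v1.1 record (route P₁ ∨ route R, p289304) is a row of the extended record.
[folklore] -/
theorem certificateRowSha_of_certificateRow {W' : WeierstrassCurve ℚ} [W'.IsElliptic]
    [W'.IsGloballyMinimal] {p : ℕ} [Fact p.Prime]
    (hrow : ((∀ [NeZero (W'.conductorNorm ℤ)] (f : CuspForm (Gamma0 (W'.conductorNorm ℤ)) 2),
        IsNewformOf W' f → ∀ (ϖ : ℚ), (ϖ : ℝ) * W'.realPeriodRat = plusPeriod f →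
        ‖coeff 1 (C (ϖ : ℚ_[p]) * padicLFunction f (unitRoot W' p : ℚ_[p]))‖ = 1) ∨
      (∃ vc v : ℤ, vc ≠ 0 ∧ AnalyticCoeffOneVal W' p vc ∧
        (∀ Dh : PAdicHeightData W' p, Dh.IsCanonical → v ≤ (padicRegulator Dh).valuation) ∧
        vc + 1 + 2 * padicValNat p W'.torsionOrder ≤
          v + padicValNat p W'.tamagawaProduct + 2 * padicValNat p (W'.reductionPointCount p)))) :
    ((∀ [NeZero (W'.conductorNorm ℤ)] (f : CuspForm (Gamma0 (W'.conductorNorm ℤ)) 2),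
        IsNewformOf W' f → ∀ (ϖ : ℚ), (ϖ : ℝ) * W'.realPeriodRat = plusPeriod f →
        ‖coeff 1 (C (ϖ : ℚ_[p]) * padicLFunction f (unitRoot W' p : ℚ_[p]))‖ = 1) ∨
      (∃ vc v : ℤ, vc ≠ 0 ∧ AnalyticCoeffOneVal W' p vc ∧
        (∀ Dh : PAdicHeightData W' p, Dh.IsCanonical → v ≤ (padicRegulator Dh).valuation) ∧
        vc + 1 + 2 * padicValNat p W'.torsionOrder ≤
          v + padicValNat p W'.tamagawaProduct + 2 * padicValNat p (W'.reductionPointCount p)) ∨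
      (∃ vc v : ℤ, vc ≠ 0 ∧ AnalyticCoeffOneVal W' p vc ∧
        (∀ Dh : PAdicHeightData W' p, Dh.IsCanonical → v ≤ (padicRegulator Dh).valuation) ∧
        vc + 1 + 2 * padicValNat p W'.torsionOrder ≤
          v + padicValNat p W'.tamagawaProduct + 2 * padicValNat p (W'.reductionPointCount p) + 2 ∧
        ∃ x : W'.sha, x ≠ 0 ∧ p • x = 0)) :=
  hrow.imp_right Or.inl

/-- **THE EXTENDED ROW RECORD, at the pair itself: an extended certificate row at a leaf pair
`(E, p)` ⇒ Mazur's main conjecture ∧ `BSD(E,p)`** (route P₁: x1b's unit-coefficient theorem; route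
R: the regulator squeeze p263077; route R-CT₂: p289683's Cassels–Tate shape). PUBLISHED facts
Wuthrich Thm. 16, BMS Thm. 1.7, Perrin-Riou 1987, Mazur–Tate `σ`, modularity, GZK, Cassels–Tate; no
main-conjecture hypothesis, no Greenberg–Vatsal parity, no `#Ш_an`.
[cite: Wuthrich2014, Thm. 16 (p. 397)] [cite: BalakrishnanMullerStein2015, Thm. 1.7]
[cite: PerrinRiou1987, §1.4 Cor. 1.8] [cite: MazurSteinTate2006, Thm. 1.3]
[cite: SilvermanAEC2009, Thm. X.4.14] -/
theorem Leaf.mazurMainConjecture_and_bsdp_of_certificateRowSha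
    (hW16 : Wuthrich2014.charIdeal_dvd_padicLFunction) (hS : Schneider1985_order_charGenerator_odd)
    (hPR : perrinRiou_rankOne_leadingTerms_odd) (hMT : mazur_tate_sigma_exists_odd)
    (hmod : nonempty_modularParametrizationData) (hGZK : rank_eq_analyticRank_of_analyticRank_le_one)
    (hCT : exists_casselsTate_pairing (K := ℚ)) (hL : Leaf W p)
    (hrow : ((∀ [NeZero (W.conductorNorm ℤ)] (f : CuspForm (Gamma0 (W.conductorNorm ℤ)) 2),
        IsNewformOf W f → ∀ (ϖ : ℚ), (ϖ : ℝ) * W.realPeriodRat = plusPeriod f →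
        ‖coeff 1 (C (ϖ : ℚ_[p]) * padicLFunction f (unitRoot W p : ℚ_[p]))‖ = 1) ∨
      (∃ vc v : ℤ, vc ≠ 0 ∧ AnalyticCoeffOneVal W p vc ∧
        (∀ Dh : PAdicHeightData W p, Dh.IsCanonical → v ≤ (padicRegulator Dh).valuation) ∧
        vc + 1 + 2 * padicValNat p W.torsionOrder ≤
          v + padicValNat p W.tamagawaProduct + 2 * padicValNat p (W.reductionPointCount p)) ∨
      (∃ vc v : ℤ, vc ≠ 0 ∧ AnalyticCoeffOneVal W p vc ∧
        (∀ Dh : PAdicHeightData W p, Dh.IsCanonical → v ≤ (padicRegulator Dh).valuation) ∧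
        vc + 1 + 2 * padicValNat p W.torsionOrder ≤
          v + padicValNat p W.tamagawaProduct + 2 * padicValNat p (W.reductionPointCount p) + 2 ∧
        ∃ x : W.sha, x ≠ 0 ∧ p • x = 0))) :
    MazurMainConjecture W p ∧ BSDp W p := by
  rcases hrow with hcoeff | ⟨vc, v, hvc, hc, hv, hb⟩ | ⟨vc, v, hvc, hc, hv, hb, hw⟩
  · exact hL.mazurMainConjecture_and_bsdp_of_norm_coeff_one_eq_one hW16 hS hPR hMT hmod hGZK hcoeff
  · exact hL.mazurMainConjecture_and_bsdp_of_coeffOneVal_of_regulatorGE hW16 hS hPR hMT hmod hGZK hvc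
      hc hv hb
  · obtain ⟨hMC, hBSD, -⟩ :=
      hL.mazurMainConjecture_and_bsdp_of_regulatorGE_of_casselsTate_of_exists_torsion hW16 hS hPR hMT
        hmod hGZK hCT hvc hc hv hb hw
    exact ⟨hMC, hBSD⟩

/-- **THE EXTENDED ROW RECORD, booking (isogeny) form: a leaf pair `(E, p)` and a globally minimal
`E′ ∼ E` carrying an extended certificate row ⇒ `BSD(E,p)`** (Cassels' isogeny invariance at
analytic rank `≤ 1`; `Leaf.of_isIsogenous`). The ONE theorem every line of the lane offer
`OFFER-T-X1R1-RP1-x1a.md` from v1.2 on instantiates: binders `hW16 hS hPR hMT hmod hmod' hGZK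
hCassels hCT` (nine published facts), per-row data `hL`, `hiso`, `hrow`.
[cite: Wuthrich2014, Thm. 16 (p. 397)] [cite: BalakrishnanMullerStein2015, Thm. 1.7]
[cite: PerrinRiou1987, §1.4 Cor. 1.8] [cite: SilvermanAEC2009, Thm. X.4.14]
[cite: MilneADT2006, Thm. I.7.3] -/
theorem Leaf.bsdp_of_isIsogenous_of_certificateRowSha
    (hW16 : Wuthrich2014.charIdeal_dvd_padicLFunction) (hS : Schneider1985_order_charGenerator_odd)
    (hPR : perrinRiou_rankOne_leadingTerms_odd) (hMT : mazur_tate_sigma_exists_odd)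
    (hmod : nonempty_modularParametrizationData) (hmod' : hasEntireLFunction_rat)
    (hGZK : rank_eq_analyticRank_of_analyticRank_le_one) (hCassels : bsdRHS_eq_of_isIsogenous)
    (hCT : exists_casselsTate_pairing (K := ℚ))
    (hL : Leaf W p) {W' : WeierstrassCurve ℚ} [W'.IsElliptic] [W'.IsGloballyMinimal]
    (hiso : IsIsogenous W W')
    (hrow : ((∀ [NeZero (W'.conductorNorm ℤ)] (f : CuspForm (Gamma0 (W'.conductorNorm ℤ)) 2),
        IsNewformOf W' f → ∀ (ϖ : ℚ), (ϖ : ℝ) * W'.realPeriodRat = plusPeriod f →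
        ‖coeff 1 (C (ϖ : ℚ_[p]) * padicLFunction f (unitRoot W' p : ℚ_[p]))‖ = 1) ∨
      (∃ vc v : ℤ, vc ≠ 0 ∧ AnalyticCoeffOneVal W' p vc ∧
        (∀ Dh : PAdicHeightData W' p, Dh.IsCanonical → v ≤ (padicRegulator Dh).valuation) ∧
        vc + 1 + 2 * padicValNat p W'.torsionOrder ≤
          v + padicValNat p W'.tamagawaProduct + 2 * padicValNat p (W'.reductionPointCount p)) ∨
      (∃ vc v : ℤ, vc ≠ 0 ∧ AnalyticCoeffOneVal W' p vc ∧
        (∀ Dh : PAdicHeightData W' p, Dh.IsCanonical → v ≤ (padicRegulator Dh).valuation) ∧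
        vc + 1 + 2 * padicValNat p W'.torsionOrder ≤
          v + padicValNat p W'.tamagawaProduct + 2 * padicValNat p (W'.reductionPointCount p) + 2 ∧
        ∃ x : W'.sha, x ≠ 0 ∧ p • x = 0))) :
    BSDp W p :=
  (Rank1ResidualX1Isogeny.bsdp_iff_of_isIsogenous hGZK hmod' hCassels W W' hiso p (by rw [hL.2])).mpr
    ((hL.of_isIsogenous hiso).mazurMainConjecture_and_bsdp_of_certificateRowSha hW16 hS hPR hMT hmod
      hGZK hCT hrow).2

/-- And `BSD(E″,p)` for EVERY globally minimal curve `E″` of the class at once (the census books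
classes): leaf pair `(E, p)`, an extended row at `E′ ∼ E`, any `E″ ∼ E` ⇒ `BSDp E″ p`.
[cite: MilneADT2006, Thm. I.7.3] [cite: Wuthrich2014, Thm. 16 (p. 397)]
[cite: SilvermanAEC2009, Thm. X.4.14] -/
theorem Leaf.bsdp_of_isIsogenous_of_isIsogenous_of_certificateRowSha
    (hW16 : Wuthrich2014.charIdeal_dvd_padicLFunction) (hS : Schneider1985_order_charGenerator_odd)
    (hPR : perrinRiou_rankOne_leadingTerms_odd) (hMT : mazur_tate_sigma_exists_odd)
    (hmod : nonempty_modularParametrizationData) (hmod' : hasEntireLFunction_rat)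
    (hGZK : rank_eq_analyticRank_of_analyticRank_le_one) (hCassels : bsdRHS_eq_of_isIsogenous)
    (hCT : exists_casselsTate_pairing (K := ℚ))
    (hL : Leaf W p) {W' : WeierstrassCurve ℚ} [W'.IsElliptic] [W'.IsGloballyMinimal]
    (hiso : IsIsogenous W W')
    (hrow : ((∀ [NeZero (W'.conductorNorm ℤ)] (f : CuspForm (Gamma0 (W'.conductorNorm ℤ)) 2),
        IsNewformOf W' f → ∀ (ϖ : ℚ), (ϖ : ℝ) * W'.realPeriodRat = plusPeriod f →
        ‖coeff 1 (C (ϖ : ℚ_[p]) * padicLFunction f (unitRoot W' p : ℚ_[p]))‖ = 1) ∨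
      (∃ vc v : ℤ, vc ≠ 0 ∧ AnalyticCoeffOneVal W' p vc ∧
        (∀ Dh : PAdicHeightData W' p, Dh.IsCanonical → v ≤ (padicRegulator Dh).valuation) ∧
        vc + 1 + 2 * padicValNat p W'.torsionOrder ≤
          v + padicValNat p W'.tamagawaProduct + 2 * padicValNat p (W'.reductionPointCount p)) ∨
      (∃ vc v : ℤ, vc ≠ 0 ∧ AnalyticCoeffOneVal W' p vc ∧
        (∀ Dh : PAdicHeightData W' p, Dh.IsCanonical → v ≤ (padicRegulator Dh).valuation) ∧
        vc + 1 + 2 * padicValNat p W'.torsionOrder ≤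
          v + padicValNat p W'.tamagawaProduct + 2 * padicValNat p (W'.reductionPointCount p) + 2 ∧
        ∃ x : W'.sha, x ≠ 0 ∧ p • x = 0)))
    {W'' : WeierstrassCurve ℚ} [W''.IsElliptic] [W''.IsGloballyMinimal] (hiso'' : IsIsogenous W W'') :
    BSDp W'' p :=
  (hL.of_isIsogenous hiso'').bsdp_of_isIsogenous_of_certificateRowSha hW16 hS hPR hMT hmod hmod' hGZK
    hCassels hCT (hiso''.symm_of_charZero.trans' hiso) hrow

/-! ## §3. Class form -/

/-- **`RankOne.Statement` ⇐ the nine PUBLISHED facts + an extended certificate row somewhere in the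
isogeny class of every leaf pair** (route P₁ or route R or route R-CT₂; type-free; no
main-conjecture hypothesis, no Greenberg–Vatsal parity, no preprint, no `#Ш_an`) — the offer's
class-level reading from v1.2 on; contains `statement_of_certificateRows` (p289304). The residue of
the class in this shape = leaf pairs whose isogeny class carries NO extended row.
[cite: Wuthrich2014, Thm. 16 (p. 397)] [cite: BalakrishnanMullerStein2015, Thm. 1.7]
[cite: PerrinRiou1987, §1.4 Cor. 1.8] [cite: SilvermanAEC2009, Thm. X.4.14]
[cite: MilneADT2006, Thm. I.7.3] -/
theorem statement_of_certificateRowsSha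
    (hW16 : Wuthrich2014.charIdeal_dvd_padicLFunction) (hS : Schneider1985_order_charGenerator_odd)
    (hPR : perrinRiou_rankOne_leadingTerms_odd) (hMT : mazur_tate_sigma_exists_odd)
    (hmod : nonempty_modularParametrizationData) (hmod' : hasEntireLFunction_rat)
    (hGZK : rank_eq_analyticRank_of_analyticRank_le_one) (hCassels : bsdRHS_eq_of_isIsogenous)
    (hCT : exists_casselsTate_pairing (K := ℚ))
    (hrows : ∀ (W : WeierstrassCurve ℚ) [W.IsElliptic] [W.IsGloballyMinimal] (p : ℕ) [Fact p.Prime],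
      Leaf W p → ∃ (W' : WeierstrassCurve ℚ) (_ : W'.IsElliptic) (_ : W'.IsGloballyMinimal),
        IsIsogenous W W' ∧
      ((∀ [NeZero (W'.conductorNorm ℤ)] (f : CuspForm (Gamma0 (W'.conductorNorm ℤ)) 2),
        IsNewformOf W' f → ∀ (ϖ : ℚ), (ϖ : ℝ) * W'.realPeriodRat = plusPeriod f →
        ‖coeff 1 (C (ϖ : ℚ_[p]) * padicLFunction f (unitRoot W' p : ℚ_[p]))‖ = 1) ∨
      (∃ vc v : ℤ, vc ≠ 0 ∧ AnalyticCoeffOneVal W' p vc ∧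
        (∀ Dh : PAdicHeightData W' p, Dh.IsCanonical → v ≤ (padicRegulator Dh).valuation) ∧
        vc + 1 + 2 * padicValNat p W'.torsionOrder ≤
          v + padicValNat p W'.tamagawaProduct + 2 * padicValNat p (W'.reductionPointCount p)) ∨
      (∃ vc v : ℤ, vc ≠ 0 ∧ AnalyticCoeffOneVal W' p vc ∧
        (∀ Dh : PAdicHeightData W' p, Dh.IsCanonical → v ≤ (padicRegulator Dh).valuation) ∧
        vc + 1 + 2 * padicValNat p W'.torsionOrder ≤
          v + padicValNat p W'.tamagawaProduct + 2 * padicValNat p (W'.reductionPointCount p) + 2 ∧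
        ∃ x : W'.sha, x ≠ 0 ∧ p • x = 0))) :
    Statement := by
  intro W _ _ p _ hL
  obtain ⟨W', _, _, hiso, hrow⟩ := hrows W p hL
  exact hL.bsdp_of_isIsogenous_of_certificateRowSha hW16 hS hPR hMT hmod hmod' hGZK hCassels hCT hiso
    hrow

/-- And Mazur's main conjecture at every leaf pair carrying an extended row ON THE PAIR ITSELF.
[cite: Wuthrich2014, Thm. 16 (p. 397)] [cite: BalakrishnanMullerStein2015, Thm. 1.7]
[cite: SilvermanAEC2009, Thm. X.4.14] -/
theorem forall_mazurMainConjecture_of_certificateRowsSha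
    (hW16 : Wuthrich2014.charIdeal_dvd_padicLFunction) (hS : Schneider1985_order_charGenerator_odd)
    (hPR : perrinRiou_rankOne_leadingTerms_odd) (hMT : mazur_tate_sigma_exists_odd)
    (hmod : nonempty_modularParametrizationData) (hGZK : rank_eq_analyticRank_of_analyticRank_le_one)
    (hCT : exists_casselsTate_pairing (K := ℚ))
    (hrows : ∀ (W : WeierstrassCurve ℚ) [W.IsElliptic] [W.IsGloballyMinimal] (p : ℕ) [Fact p.Prime],
      Leaf W p →
      ((∀ [NeZero (W.conductorNorm ℤ)] (f : CuspForm (Gamma0 (W.conductorNorm ℤ)) 2),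
        IsNewformOf W f → ∀ (ϖ : ℚ), (ϖ : ℝ) * W.realPeriodRat = plusPeriod f →
        ‖coeff 1 (C (ϖ : ℚ_[p]) * padicLFunction f (unitRoot W p : ℚ_[p]))‖ = 1) ∨
      (∃ vc v : ℤ, vc ≠ 0 ∧ AnalyticCoeffOneVal W p vc ∧
        (∀ Dh : PAdicHeightData W p, Dh.IsCanonical → v ≤ (padicRegulator Dh).valuation) ∧
        vc + 1 + 2 * padicValNat p W.torsionOrder ≤
          v + padicValNat p W.tamagawaProduct + 2 * padicValNat p (W.reductionPointCount p)) ∨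
      (∃ vc v : ℤ, vc ≠ 0 ∧ AnalyticCoeffOneVal W p vc ∧
        (∀ Dh : PAdicHeightData W p, Dh.IsCanonical → v ≤ (padicRegulator Dh).valuation) ∧
        vc + 1 + 2 * padicValNat p W.torsionOrder ≤
          v + padicValNat p W.tamagawaProduct + 2 * padicValNat p (W.reductionPointCount p) + 2 ∧
        ∃ x : W.sha, x ≠ 0 ∧ p • x = 0))) :
    ∀ (W : WeierstrassCurve ℚ) [W.IsElliptic] [W.IsGloballyMinimal] (p : ℕ) [Fact p.Prime],
      Leaf W p → MazurMainConjecture W p :=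
  fun W _ _ p _ hL ↦
    (hL.mazurMainConjecture_and_bsdp_of_certificateRowSha hW16 hS hPR hMT hmod hGZK hCT
      (hrows W p hL)).1

end Summit.BirchSwinnertonDyer.Rank1Residual.X1.RankOne

end
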